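import Summits.CriticalPhenomena.PercolationContinuityZ3.Theorems.Transplant.KNCells2TubeSub
import Summits.CriticalPhenomena.PercolationContinuityZ3.Theorems.Transplant.KNCellsBoxProdZ2ConcHout
import Summits.CriticalPhenomena.PercolationContinuityZ3.Theorems.Transplant.KNCellsBoxProdZ2ConcSepQ
import Summits.CriticalPhenomena.PercolationContinuityZ3.Theorems.Transplant.KNCells2KitResidues
import Summits.CriticalPhenomena.PercolationContinuityZ3.Theorems.Transplant.BoxProdZ2ConcAssemblyG
import HarnessLib

/-!
# Design (D), instance assembly: the CORRIDOR RESIDUE `ReachOblAt` of stmt-g5's closure (KNCells2KitResidues) for the concentric scheme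
# `concSchemeG X C w₀ Λ q δc` (geometry of record `cellGeomCG`, p3-g2) at one chosen valid probe `(h, e)` and onward direction `du`, from a
# tube corridor chain `P : TubeChainData W` over the window `B_X(w₀, E)`, five RADIUS facts of the schedule, the planar/fibre containments
# (this seat) and — as hypotheses in p3-g2's vocabulary — the per-step kit clauses (`BoxProdZ2ConcKits.hkits_tube`), the rim excess and the count

builds on p205010 (kernel theorem, internal audit signed; external expert review pending) — nothing in this file uses p205010.
Lane `prim-bschramm`, seat `prim-bschramm-p2` (instance assembly A3, stmt's division 14:56:14Z: "p2 = TubeChainData for cellGeomCG +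
hout_of_valid ⟹ the containment fields"); helper file (`--supports stmt-CriticalPhenomena-4575`).

THE RADIUS FACTS (probe `e = (x, δ)`, `y = tgt e`, `α = aOf₁`, departure anchor `a'`; p3-g2 14:46Z (a): with `Λ := concRadiiGB …` all hold
in the realised cases by `concRadiiGB_ρ_eq` / `_rE_eq` and p5-g3's `anchors_of_choice`): `rQ α y = E` (the tube IS the cube's fibre ball),
`ρ a' y du · = E` (the corridor rows have the tube's radius), `rB α x δ ≤ E` (thin between-box), `E ≤ rE a' y du`, `E ≤ rM a' (y + du)`
(the target cube is law-fat: `F - L' ≥ E`).  From them: every step region `π × region_i ⊆ π × (C.Q y ∪ C.Hfull y du)` lies in the habitat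
`Q_α(y) ∪ E^far_{a'}(y,du)`, in `Sx`, in `Ucor`; the explored region cannot touch it (`qSepGeomCG`, p3 p221536); its `X □ ℤ²`-neighbours in
`E_{x,y} ∪ H_{y,·}` are tube-neighbours (`tube_adj_of_mem_Ewv_Hfull`, p221432) — so `Wcor` is a subbox weighting of the tube graph on it
(`isSubbox_Wcor_tube`, p222000); the arrival cube `M_α(y)` sits in the first core (`WF.MQ`), the last true target in `M_{a'}(y + du)`.
* **`reachOblAt_concG`** — `KSchA.ReachOblAt X (concSchemeG X C w₀ Λ q δc) (faceDataCG X C w₀ Λ) Δ' δ h e a' du`.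
[cite: KozmaNitzan2024, §4 Lemma 12 (pp. 23–25), p. 26 (M_x, H_{v,x}), p. 30 (Step IV), p. 31]
-/

noncomputable section

open MeasureTheory ProbabilityTheory
open scoped ENNReal Classical

namespace Summit.CriticalPhenomena.PercolationContinuityZ3.Theorems

namespace Transplant

namespace BoxProdZ2

open Literature.Probability.Percolation Literature.Probability.LatticeModels SimpleGraph GadgetSystem ProbeHistory HSiteScheme Contour KNCells
open Literature.Barriers.CriticalPhenomena (mem_graphBall_self)

variable {W : Type} [DecidableEq W] (X : SimpleGraph W) [X.LocallyFinite]

/-- **THE CORRIDOR RESIDUE OF THE CONCENTRIC SCHEME AT ONE PROBE** (design (D)). [cite: KozmaNitzan2024, §4 Lemma 12 (pp. 23–25), p. 30 (Step IV), p. 31] -/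
theorem reachOblAt_concG (C : PCells) (w₀ : W) {Λ : ConcRadiiG} (hΛ : Λ.WF C) {q : unitInterval} {δc : ℝ}
    {h : ProbeHistory (W × Site 2)} {e : Site 2 × MDir} (hV : (concSchemeG X C w₀ Λ q δc).Valid₂ (X □ zdGraph 2) h e)
    {a' : ℕ} {du : MDir} (hdu : du ∈ (concSchemeG X C w₀ Λ q δc).onward (X □ zdGraph 2) h (tgt e))
    (P : TubeChainData W) {E : ℕ} (hPπ : P.π = ballFin X w₀ E) (hPC : P.C = C) (hPx : P.x = tgt e) (hPdu : P.du = du)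
    (hProot : P.root = (w₀, 0))
    (hPS : P.Sfin = (concSchemeG X C w₀ Λ q δc).Sx (X □ zdGraph 2) h e ((concSchemeG X C w₀ Λ q δc).aOf₁ (X □ zdGraph 2) h e) a' du)
    (hRim : ∀ i, P.Rim i ⊆ P.stepD i)
    (hEQ : Λ.rQ ((concSchemeG X C w₀ Λ q δc).aOf₁ (X □ zdGraph 2) h e) (tgt e) = E) (hρ : ∀ ℓ, Λ.ρ a' (tgt e) du ℓ = E)
    (hB : Λ.rB ((concSchemeG X C w₀ Λ q δc).aOf₁ (X □ zdGraph 2) h e) e.1 e.2 ≤ E) (hEfar : E ≤ Λ.rE a' (tgt e) du)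
    (hM : E ≤ Λ.rM a' (tgt e + stepVec du))
    (hr : P.C.r = 4 * P.t) (hR : 100 * P.R' ≤ P.t) (hRl : P.Rlev + 1 ≤ P.R') (hj : P.j₁ ≤ P.Rlev)
    {Δ' : ℕ} {δ η : ℝ} (hcount : 1 / (1 - (q : ℝ)) ^ (Δ' * P.N) ≤ δ * ((Finset.Icc P.j₀ P.j₁).card : ℝ))
    (hkits : ∀ i ≤ ChainPlanar.Sched.nLast, ∀ j ∈ Finset.Icc P.j₀ P.j₁,
      ∃ (σ : KNLevels.SData (W × Site 2)) (Sz : Finset (W × Site 2)),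
      KNLevels.SHyp (tubeLData X P.π (P.lo i) (P.hi i) P.root P.Sfin) j σ ∧ σ.N ≤ P.N ∧
      (1 - (q : ℝ) ^ σ.sB) ^ σ.k ≤ δ ∧ Sz ⊆ (tubeLData X P.π (P.lo i) (P.hi i) P.root P.Sfin).X j ∧ Sz ⊆ P.stepD i ∧
      (∀ x ∈ σ.K, ∀ e' ∈ σ.seed x, e' ∉ wireSet (↑Sz : Set (W × Site 2))) ∧ (∀ x ∈ σ.K, σ.face x ⊆ Sz) ∧
      (∀ x ∈ σ.K, 1 - 3 * δ ≤ (prodBernoulli ((concSchemeG X C w₀ Λ q δc).Wcor (X □ zdGraph 2) (faceDataCG X C w₀ Λ) h e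
          ((concSchemeG X C w₀ Λ q δc).aOf₁ (X □ zdGraph 2) h e) a' du)).real {ω | ∃ u ∈ σ.face x,
        1 - δ < (prodBernoulli (pinW ((concSchemeG X C w₀ Λ q δc).Wcor (X □ zdGraph 2) (faceDataCG X C w₀ Λ) h e
          ((concSchemeG X C w₀ Λ q δc).aOf₁ (X □ zdGraph 2) h e) a' du) (wireSet (↑Sz : Set (W × Site 2))) ω)).real
          (⋃ t ∈ P.tgtE i, openConnIn (↑(P.stepD i) : Set (W × Site 2)) u t)}))
    (hη : η ≤ δ / 2)
    (hexc : ∀ i ≤ ChainPlanar.Sched.nLast, (prodBernoulli ((concSchemeG X C w₀ Λ q δc).Wcor (X □ zdGraph 2) (faceDataCG X C w₀ Λ) h e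
        ((concSchemeG X C w₀ Λ q δc).aOf₁ (X □ zdGraph 2) h e) a' du)).real (⋃ t ∈ P.Rim i, openConn ((w₀, (0 : Site 2)) : W × Site 2) t) ≤ η) :
    KSchA.ReachOblAt X (concSchemeG X C w₀ Λ q δc) (faceDataCG X C w₀ Λ) Δ' δ h e a' du := by
  -- abbreviations
  set S := concSchemeG X C w₀ Λ q δc with hSdef
  set α := S.aOf₁ (X □ zdGraph 2) h e with hαdef
  have hΓ : S.Γ = cellGeomCG X C w₀ Λ := rfl
  have hL := levelGeomCG X C w₀ hΛ
  have hQ := qSepGeomCG X C w₀ Λ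
  have hw₀ : w₀ ∈ ballFin X w₀ E := (mem_ballFin X).2 (mem_graphBall_self X w₀ _)
  -- the habitat containment of the step regions
  have hab : ∀ i ≤ ChainPlanar.Sched.nLast, P.stepD i ⊆ S.Γ.Q α (tgt e) ∪ S.Γ.Efar a' (tgt e) du := by
    intro i hi v hv
    have hv' := TubeChainData.stepD_subset hr hR hi hv
    rw [hPπ, hPC, hPx, hPdu, Finset.mem_product] at hv'
    obtain ⟨hv1, hv2⟩ := hv'
    rcases Finset.mem_union.1 hv2 with hv2 | hv2
    · refine Finset.mem_union_left _ (Finset.mem_product.2 ⟨?_, hv2⟩)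
      exact ballFin_mono X w₀ (le_of_eq hEQ.symm) hv1
    · rcases Finset.mem_union.1 (C.Hfull_subset_Q_union_Efar (tgt e) du hv2) with hv3 | hv3
      · exact Finset.mem_union_left _ (Finset.mem_product.2 ⟨ballFin_mono X w₀ (le_of_eq hEQ.symm) hv1, hv3⟩)
      · exact Finset.mem_union_right _ (Finset.mem_product.2 ⟨ballFin_mono X w₀ hEfar hv1, hv3⟩)
  -- … in `Sx`
  have hSx : ∀ i ≤ ChainPlanar.Sched.nLast, P.stepD i ⊆ S.Sx (X □ zdGraph 2) h e α a' du := by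
    intro i hi v hv
    rcases Finset.mem_union.1 (hab i hi hv) with hv | hv
    · exact Finset.mem_union_left _ (Finset.mem_union_right _ (Finset.mem_union_right _ hv))
    · exact Finset.mem_union_right _ hv
  -- … in `Ucor`
  have hUc : ∀ i ≤ ChainPlanar.Sched.nLast, P.stepD i ⊆ S.Ucor (X □ zdGraph 2) (faceDataCG X C w₀ Λ) h e α a' du := by
    intro i hi v hv
    have hv' := TubeChainData.stepD_subset hr hR hi hv
    rw [hPπ, hPC, hPx, hPdu, Finset.mem_product] at hv'
    obtain ⟨hv1, hv2⟩ := hv'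
    rcases Finset.mem_union.1 hv2 with hv2 | hv2
    · refine Finset.mem_union_left _ (Finset.mem_union_right _ (Finset.mem_union_right _ (Finset.mem_product.2 ⟨?_, hv2⟩)))
      exact ballFin_mono X w₀ (le_of_eq hEQ.symm) hv1
    · refine Finset.mem_union_right _ ?_
      change v ∈ stair X w₀ (fun t => Λ.ρ a' (tgt e) du (C.lev du (tgt e) t)) (C.Hfull (tgt e) du)
      rw [mem_stair]
      exact ⟨hv2, ballFin_mono X w₀ (le_of_eq (hρ _).symm) hv1⟩
  -- fibres of the regions lie in the window
  have hfib : ∀ i, ∀ u ∈ P.stepD i, u.1 ∈ P.π := fun i u hu => (Finset.mem_product.1 hu).1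
  -- the subbox property in the tube graph
  have hsub : ∀ i ≤ ChainPlanar.Sched.nLast,
      KNLevels.IsSubbox (tubeGraph X P.π) (S.Wcor (X □ zdGraph 2) (faceDataCG X C w₀ Λ) h e α a' du) S.p (P.stepD i) := by
    intro i hi
    refine KSchA.isSubbox_Wcor_tube X P.π hL hQ hV hdu (hab i hi) (hSx i hi) (hUc i hi) (hfib i) fun v hv x hx hadj => ?_
    have hv1 : v.1 ∈ ballFin X w₀ E := by rw [← hPπ]; exact hfib i v hv
    rw [hPπ]
    exact tube_adj_of_mem_Ewv_Hfull (X := X) hB (le_of_eq hEQ) (fun ℓ => le_of_eq (hρ ℓ)) hx hv1 hadj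
  refine ⟨P, ballFin X w₀ (Λ.rM α (tgt e)), η, ?_, hr, hR, hRl, hRim, ?_, hj, hcount, hsub, ?_, ?_, ?_, ?_, hkits, hη, ?_, ?_, ?_, ?_⟩
  · -- the sources agree
    rw [hProot]; rfl
  · -- the window is nonempty
    rw [hPπ]; exact ⟨w₀, hw₀⟩
  · -- finite support
    rw [hPS]; exact KSchA.finSupp_Wcor
  · -- regions inside the support
    intro i hi; rw [hPS]; exact hSx i hi
  · -- the root is off every region
    intro i hi; rw [hProot]; exact KSchA.root_not_mem_of_fresh hL hQ hV hdu (hab i hi)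
  · -- the root is in the support
    rw [hProot, hPS]; exact Finset.mem_union_left _ (Finset.mem_union_left _ hV.root_mem)
  · -- the rim excess
    intro i hi; exact hexc i hi
  · -- the arrival window lies in the tube
    rw [hPπ]; exact ballFin_mono X w₀ ((hΛ.MQ α (tgt e)).trans (le_of_eq hEQ))
  · -- the arrival cube lies in `π' × M_y`
    rw [hPC, hPx]; exact subset_rfl
  · -- the last true target lies in `M_{a'}(y + du)`
    rw [hPπ, hPC, hPx, hPdu]
    exact Finset.product_subset_product (ballFin_mono X w₀ hM) Finset.inter_subset_left

end BoxProdZ2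

end Transplant

end Summit.CriticalPhenomena.PercolationContinuityZ3.Theorems

end
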